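import Literature.AlgebraicGeometry.Motives.AbelianVarietyConjugate
import Literature.AlgebraicGeometry.Motives.AbelianVarietyQuotientAction
import Literature.AlgebraicGeometry.Motives.AbelianVarietyWeilPairingAlternating
import Literature.AlgebraicGeometry.Motives.CyclesDimensionFunctionField
import HarnessLib

/-!
# The level Weil pairing under base change: `ē_N^{Θ_L}(P, Q) = σ(ē_N^Θ(P₀, Q₀))` along a field map `σ : k → L`
# (Lang VII §2; Milne 1986 §16: the pairing is defined over the ground field)

Layer `Literature/AlgebraicGeometry/Motives`, namespace `Literature.AlgebraicGeometry.Motives.AbelianVariety`.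
KERNEL ONLY: theorems; no definition, no instance, no named fact, no `sorry`.

The Weil pairing `ē_N^Θ(P, Q) = t_P^♯ g_Q / g_Q` of the tree (`Motives/AbelianVarietyWeilPairingLevel`) is a
rational expression in data defined over the ground field, hence is COMPATIBLE WITH EXTENSION OF SCALARS: for a
homomorphism of fields `σ : k → L`, the base change `A_σ = A ×_{k,σ} L` (`AbelianVariety.baseChangeAlong`,
`Motives/AbelianVarietyConjugate` §1; for an algebra `L/k` the tree's `A.baseChange L`) with projection `π : A_σ → A`,
and `N`-torsion points `P, Q ∈ A_σ(L)` LYING OVER `P₀, Q₀ ∈ A(k)` (`P ≫ π = Spec σ ≫ P₀`),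

  **`ē_N^{π^*Θ}(P, Q) = σ (ē_N^Θ(P₀, Q₀))`**   (`weilPairingLevel_baseChangeAlong`, `weilPairingLevel_baseChange`).

Lang, *Abelian Varieties*, VII §2 (`e_N` is defined over the field of definition of `A`, `X`, `a`); Milne 1986 §16
(`ē_m` commutes with base change — this is what makes it a pairing of `Gal(k̄/k)`-modules); Mumford §20.  Special
cases: `σ` an automorphism of `L` = the conjugate `A^σ` (`weilPairingLevel_conjugate`,
`Motives/AbelianVarietyWeilPairingConjugate`); `σ = (k ⊆ k̄)`, `(L ⊆ ℂ)`: comparison of the pairings on `A(k)`,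
`A(k̄)`, `A(ℂ)`.

§1 is the ABSTRACT TRANSPORT THEOREM behind all of these (and behind `weilPairingLevel_pullback`,
`Motives/AbelianVarietyWeilPairingPullback`): for abelian varieties `A/k`, `B/L`, a dominant morphism of schemes
`π : B → A` which (i) twists constants by `σ` (`π^♯ c = σ c`), (ii) commutes with `[N]`, and points `P, Q` of `B`,
`P₀, Q₀` of `A` whose translations correspond under `π` (`t_P ≫ π = π ≫ t_{P₀}`), one has
`ē_N^{π^*Θ}(P, Q) = σ(ē_N^Θ(P₀, Q₀))` (`weilPairingLevel_transport`).  §2–§3 discharge (i)–(ii) and the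
translation condition for `baseChangeAlong σ` and `baseChange L` (`transl_fst` of `Motives/AbelianVarietyQuotientAction`).
DESIGN NOTE: the projection is passed as a variable `π` typed on `(A.baseChangeAlong σ).X.left` (resp.
`(A.baseChange L).X.left`) with a defining equation `hπ` — on the bare `baseChangeHomFst σ A.X` (source
`((baseChangeHom σ).obj A.X).left`) instance search does not find `IsIntegral`, so `Θ.pullback`/`functionFieldMap`
would not elaborate.

Use (cell `hodgecm-mathlib`, row II-1 `shimura1998_thm18_6` v2, S5/S7): the uniformisations live on `A_L ⊗ ℂ`
(ℂ-points), the reduction data on `A_L` and its `L̄`-points — this file moves the Weil pairings between them.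

## References
* [Lang1983AbelianVarieties] S. Lang, *Abelian Varieties*, Ch. VII §2, Props. 2–3 (PDF pp. 138–139).
* [Milne1986AbelianVarieties] J. S. Milne, *Abelian varieties*, in Cornell–Silverman (1986), §16, p. 131.
* [MumfordAV1970] D. Mumford, *Abelian Varieties* (1970), §20.
-/

universe u

open CategoryTheory CategoryTheory.Limits AlgebraicGeometry MonoidalCategory CartesianMonoidalCategory

noncomputable section

namespace Literature.AlgebraicGeometry.Motives

open scoped MonObj
open RatFn

namespace AbelianVariety

/-! ### §1 The abstract transport theorem -/

section Transport

variable {k L : Type u} [Field k] [Field L] (σ : k →+* L) {A : AbelianVariety k} {B : AbelianVariety L}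
  (π : B.X.left ⟶ A.X.left) [IsDominant π]

/-- `D_Q(π^*Θ) = π^* D_{Q₀}(Θ)` as divisors, when `t_Q ≫ π = π ≫ t_{Q₀}`. [cite: Lang1983AbelianVarieties, Ch. VII §2 Prop. 3] -/
theorem weilDiv_transport_sameDivisor (Θ : CartierDivisor A.X.left) {Q₀ : A.Points k} {Q : B.Points L}
    (hQ : (B.translation Q).left ≫ π = π ≫ (A.translation Q₀).left) :
    (B.weilDiv (Θ.pullback π) Q).SameDivisor ((A.weilDiv Θ Q₀).pullback π) := by
  haveI : IsDominant ((B.translation Q).left ≫ π) := inferInstance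
  haveI : IsDominant (π ≫ (A.translation Q₀).left) := inferInstance
  have h1 : ((Θ.pullback π).pullback (B.translation Q).left).SameDivisor
      ((Θ.pullback (A.translation Q₀).left).pullback π) :=
    ((Θ.pullback_pullback_sameDivisor _ _).trans (Θ.pullback_congr_sameDivisor hQ)).trans
      (Θ.pullback_pullback_sameDivisor _ _).symm
  have h2 : (-(Θ.pullback π)).SameDivisor ((-Θ).pullback π) := (CartierDivisor.pullback_neg_sameDivisor _ Θ).symm
  exact (h1.add h2).trans (CartierDivisor.pullback_add_sameDivisor _ _ _).symm

variable {N : ℕ} [IsDominant (Hom.toSchemeHom ((N : ℤ) • 𝟙 A))] [IsDominant (Hom.toSchemeHom ((N : ℤ) • 𝟙 B))]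

/-- `π^♯ g` trivializes `[N]_B^* π^* E` if `g` trivializes `[N]_A^* E` and `π` commutes with `[N]`.
[cite: Lang1983AbelianVarieties, Ch. VII §2 Prop. 3] -/
theorem IsTrivializer.transport (hN : π ≫ Hom.toSchemeHom ((N : ℤ) • 𝟙 A) = Hom.toSchemeHom ((N : ℤ) • 𝟙 B) ≫ π)
    {E : CartierDivisor A.X.left} {g : A.X.left.functionField} (hg : A.IsTrivializer (n := N) E g) :
    B.IsTrivializer (n := N) (E.pullback π) (functionFieldMap π g) := by
  refine ⟨(map_ne_zero _).2 hg.1, fun i x hi => ?_⟩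
  have hi' : Hom.toSchemeHom ((N : ℤ) • 𝟙 A) (π x) ∈ E.U i := by
    rw [← Scheme.Hom.comp_apply, hN, Scheme.Hom.comp_apply]
    exact hi
  have h1 : IsUnitAt x (functionFieldMap π (functionFieldMap (Hom.toSchemeHom ((N : ℤ) • 𝟙 A)) (E.f i) * g)) :=
    (hg.2 i _ hi').functionFieldMap
  rw [map_mul] at h1
  haveI : IsDominant (π ≫ Hom.toSchemeHom ((N : ℤ) • 𝟙 A)) := inferInstance
  haveI : IsDominant (Hom.toSchemeHom ((N : ℤ) • 𝟙 B) ≫ π) := inferInstance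
  have h2 := functionFieldMap_comp (Hom.toSchemeHom ((N : ℤ) • 𝟙 A)) π
  have h3 := functionFieldMap_comp π (Hom.toSchemeHom ((N : ℤ) • 𝟙 B))
  have h4 : functionFieldMap (π ≫ Hom.toSchemeHom ((N : ℤ) • 𝟙 A)) =
      functionFieldMap (Hom.toSchemeHom ((N : ℤ) • 𝟙 B) ≫ π) :=
    functionFieldMap_congr hN
  rw [h2, h3] at h4
  have h5 := congrArg (fun φ => φ (E.f i)) h4
  simp only [RingHom.coe_comp, Function.comp_apply] at h5
  convert h1 using 2
  rw [CartierDivisor.pullback_f]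
  exact h5.symm

/-- **Abstract transport of the Weil pairing.**  Let `π : B → A` be a dominant morphism between the underlying
schemes of abelian varieties `A/k`, `B/L` which twists constants by `σ : k → L` (`hconst`) and commutes with `[N]`
(`hN`), and let `P, Q ∈ B[N](L)`, `P₀, Q₀ ∈ A[N](k)` have corresponding translations (`t_P ≫ π = π ≫ t_{P₀}`, same
for `Q`).  Then `ē_N^{π^*Θ}(P, Q) = σ(ē_N^Θ(P₀, Q₀))`: `π^♯ g_{Q₀}` trivializes `[N]^* D_Q(π^*Θ) = π^*[N]^*D_{Q₀}`, and
`t_P^♯ π^♯ g / π^♯ g = π^♯(t_{P₀}^♯ g / g) = π^♯ ē(P₀, Q₀) = σ ē(P₀, Q₀)`. [cite: Lang1983AbelianVarieties, Ch. VII §2 Prop. 3]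
[cite: Milne1986AbelianVarieties, §16 (p. 131, the pairings ē_m)] -/
theorem weilPairingLevel_transport
    (hconst : ∀ c : k, functionFieldMap π (algebraMap k A.X.left.functionField c) =
      algebraMap L B.X.left.functionField (σ c))
    (hN : π ≫ Hom.toSchemeHom ((N : ℤ) • 𝟙 A) = Hom.toSchemeHom ((N : ℤ) • 𝟙 B) ≫ π)
    (Θ : CartierDivisor A.X.left) (P₀ Q₀ : A.torsionPoints k N) (P Q : B.torsionPoints L N)
    (hP : (B.translation P.1).left ≫ π = π ≫ (A.translation P₀.1).left)
    (hQ : (B.translation Q.1).left ≫ π = π ≫ (A.translation Q₀.1).left) :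
    B.weilPairingLevel (Θ.pullback π) P Q = σ (A.weilPairingLevel Θ P₀ Q₀) := by
  have hg : A.IsTrivializer (n := N) (A.weilDiv Θ Q₀.1) (A.weilFn Θ Q₀) := A.isTrivializer_weilFn Θ Q₀
  have hg' : B.IsTrivializer (n := N) (B.weilDiv (Θ.pullback π) Q.1) (functionFieldMap π (A.weilFn Θ Q₀)) :=
    (IsTrivializer.transport π hN hg).of_sameDivisor (weilDiv_transport_sameDivisor π Θ hQ).symm
  rw [weilPairingLevel_eq_kummerConst (Q := Q) hg' P]
  apply (algebraMap L B.X.left.functionField).injective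
  rw [algebraMap_kummerConst]
  haveI : IsDominant ((B.translation P.1).left ≫ π) := inferInstance
  haveI : IsDominant (π ≫ (A.translation P₀.1).left) := inferInstance
  have hFF : (functionFieldMap (B.translation P.1).left).comp (functionFieldMap π) =
      (functionFieldMap π).comp (functionFieldMap (A.translation P₀.1).left) := by
    have h := functionFieldMap_congr hP
    rw [functionFieldMap_comp, functionFieldMap_comp] at h
    exact h
  change functionFieldMap (B.translation P.1).left (functionFieldMap π (A.weilFn Θ Q₀)) /
      functionFieldMap π (A.weilFn Θ Q₀) = _
  rw [← RingHom.comp_apply (functionFieldMap (B.translation P.1).left), hFF, RingHom.comp_apply, ← map_div₀]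
  change functionFieldMap π (A.translFF P₀.1 (A.weilFn Θ Q₀) / A.weilFn Θ Q₀) = _
  rw [← algebraMap_kummerConst hg P₀, hconst]
  rfl

end Transport

/-! ### §2 Base change along a field homomorphism `σ : k → L` (`A.baseChangeAlong σ`) -/

section Along

variable {k L : Type u} [Field k] [Field L] (σ : k →+* L) (A : AbelianVariety k)

/-- The projection `π : A_σ → A` is dominant (surjective: base change of `Spec L → Spec k`, a map of points).
[cite: GortzWedhorn2020, Section (4.7) and Prop. 4.16] -/
theorem isDominant_baseChangeHomFst_along : IsDominant (baseChangeHomFst σ A.X) := by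
  haveI : Surjective (baseChangeHomFst σ A.X) :=
    MorphismProperty.pullback_fst _ _ ⟨fun _ ↦ ⟨Classical.arbitrary _, Subsingleton.elim _ _⟩⟩
  exact ⟨(‹Surjective (baseChangeHomFst σ A.X)›).1.denseRange⟩

variable (π : (A.baseChangeAlong σ).X.left ⟶ A.X.left) (hπ : π = baseChangeHomFst σ A.X)

include hπ in
/-- **`π^♯ c = σ c` on constants** for the projection `π : A_σ → A` (`π ≫ (A → Spec k) = pr₂ ≫ Spec σ`).
[cite: GortzWedhorn2020, Section (4.7) and Prop. 4.16] -/
theorem functionFieldMap_baseChangeAlongFst_algebraMap [IsDominant π] (c : k) :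
    functionFieldMap π (algebraMap k A.X.left.functionField c) =
      algebraMap L (A.baseChangeAlong σ).X.left.functionField (σ c) := by
  rw [algebraMap_stalk_apply, algebraMap_stalk_apply]
  have hcond : π ≫ (A.X.left ↘ Spec (.of k)) =
      ((A.baseChangeAlong σ).X.left ↘ Spec (.of L)) ≫ Spec.map (CommRingCat.ofHom σ) := by
    rw [hπ]
    exact pullback.condition
  rw [functionFieldMap_algebraMap_top (A.X.left ↘ Spec (.of k)) π _ rfl c,
    hcond, Scheme.Hom.comp_appTop, CommRingCat.comp_apply]
  congr 2
  have h := congrArg (fun φ => φ.hom c) (Scheme.ΓSpecIso_inv_naturality (CommRingCat.ofHom σ))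
  simp only [CommRingCat.hom_comp, RingHom.coe_comp, Function.comp_apply, CommRingCat.hom_ofHom] at h
  exact h.symm

/-- `(n • 𝟙 A)_σ = n • 𝟙 A_σ`. [cite: Milne2005ShimuraVarieties, §11 p. 108 («α ↦ σα»)] -/
theorem baseChangeAlong_zsmul_id (n : ℤ) : Hom.baseChangeAlong σ (n • 𝟙 A) = n • 𝟙 (A.baseChangeAlong σ) := by
  change A.endBaseChangeAlong σ (n • (1 : End A)) = n • (1 : End (A.baseChangeAlong σ))
  rw [map_zsmul, map_one]

include hπ in
/-- `π ≫ [n]_A = [n]_{A_σ} ≫ π`. [cite: Milne2005ShimuraVarieties, §11 p. 108 («α ↦ σα»)] -/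
theorem baseChangeAlongFst_comp_zsmul (n : ℤ) :
    π ≫ Hom.toSchemeHom (n • 𝟙 A) = Hom.toSchemeHom (n • 𝟙 (A.baseChangeAlong σ)) ≫ π := by
  rw [hπ, ← baseChangeAlong_zsmul_id]
  exact (Hom.toSchemeHom_baseChangeAlong_comp_fst σ (n • 𝟙 A)).symm

include hπ in
/-- **`t_P ≫ π = π ≫ t_{P₀}`** for a point `P ∈ A_σ(L)` lying over `P₀ ∈ A(k)` (`P ≫ π = Spec σ ≫ P₀`): on `T`-points
both composites are «multiply the projection by the constant point `T → Spec L →^{Spec σ ≫ P₀} A`» (`transl_fst`).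
[cite: GortzWedhorn2023, Def. 27.1 (p. 799)] -/
theorem translation_left_comp_baseChangeAlongFst (P : (A.baseChangeAlong σ).Points L) (P₀ : A.Points k)
    (hP : P.left ≫ π = Spec.map (CommRingCat.ofHom σ) ≫ P₀.left) :
    ((A.baseChangeAlong σ).translation P).left ≫ π = π ≫ (A.translation P₀).left := by
  subst hπ
  obtain ⟨s, rfl⟩ := (A.pointsAlong σ).surjective P
  have hs : s.left = Spec.map (CommRingCat.ofHom σ) ≫ P₀.left := by
    rw [← A.pointsAlong_left_comp_fst σ s]
    exact hP
  have h1 : ((A.baseChangeAlong σ).translation (A.pointsAlong σ s)).left ≫ baseChangeHomFst σ A.X =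
      (A.constPt (AlongHom L σ) s * A.fstPt (AlongHom L σ)).left :=
    A.transl_fst (AlongHom L σ) s
  have h2 : A.constPt (AlongHom L σ) s = toSpecOver (A.bcOverK (AlongHom L σ)) ≫ P₀ := by
    apply Over.OverMorphism.ext
    rw [constPt_left, hs, Over.comp_left, toSpecOver_left]
    exact (Category.assoc _ _ _).symm
  have h3 : A.constPt (AlongHom L σ) s * A.fstPt (AlongHom L σ) = A.fstPt (AlongHom L σ) ≫ A.translation P₀ := by
    rw [h2, translation, MonObj.comp_mul, Category.comp_id, ← Category.assoc, comp_toSpecOver_eq']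
  rw [h1, h3, Over.comp_left, fstPt_left]
  rfl

include hπ in
/-- **The Weil pairing commutes with base change along `σ : k → L`**: for `P, Q ∈ A_σ[N](L)` lying over
`P₀, Q₀ ∈ A[N](k)`, `ē_N^{π^*Θ}(P, Q) = σ(ē_N^Θ(P₀, Q₀))`. [cite: Lang1983AbelianVarieties, Ch. VII §2 Prop. 3]
[cite: Milne1986AbelianVarieties, §16 (p. 131, the pairings ē_m)] -/
theorem weilPairingLevel_baseChangeAlong [IsDominant π] {N : ℕ} [IsDominant (Hom.toSchemeHom ((N : ℤ) • 𝟙 A))]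
    [IsDominant (Hom.toSchemeHom ((N : ℤ) • 𝟙 (A.baseChangeAlong σ)))]
    (Θ : CartierDivisor A.X.left) (P₀ Q₀ : A.torsionPoints k N) (P Q : (A.baseChangeAlong σ).torsionPoints L N)
    (hP : (P : (A.baseChangeAlong σ).Points L).left ≫ π = Spec.map (CommRingCat.ofHom σ) ≫ (P₀ : A.Points k).left)
    (hQ : (Q : (A.baseChangeAlong σ).Points L).left ≫ π = Spec.map (CommRingCat.ofHom σ) ≫ (Q₀ : A.Points k).left) :
    (A.baseChangeAlong σ).weilPairingLevel (Θ.pullback π) P Q = σ (A.weilPairingLevel Θ P₀ Q₀) :=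
  weilPairingLevel_transport σ π (A.functionFieldMap_baseChangeAlongFst_algebraMap σ π hπ)
    (A.baseChangeAlongFst_comp_zsmul σ π hπ N) Θ P₀ Q₀ P Q
    (A.translation_left_comp_baseChangeAlongFst σ π hπ P.1 P₀.1 hP)
    (A.translation_left_comp_baseChangeAlongFst σ π hπ Q.1 Q₀.1 hQ)

end Along

/-! ### §3 Base change along an algebra `L/k` (`A.baseChange L`) -/

section BaseChange

variable {k : Type u} [Field k] (L : Type u) [Field L] [Algebra k L] (A : AbelianVariety k)

/-- The projection `pr₁ : A_L → A` is dominant. [cite: GortzWedhorn2020, Section (4.7) and Prop. 4.16] -/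
theorem isDominant_baseChangeFst : IsDominant (pullback.fst A.X.hom (bcSpec k L)) := by
  haveI : Surjective (pullback.fst A.X.hom (bcSpec k L)) :=
    MorphismProperty.pullback_fst _ _ ⟨fun _ ↦ ⟨Classical.arbitrary _, Subsingleton.elim _ _⟩⟩
  exact ⟨(‹Surjective (pullback.fst A.X.hom (bcSpec k L))›).1.denseRange⟩

variable (π : (A.baseChange L).X.left ⟶ A.X.left) (hπ : π = pullback.fst A.X.hom (bcSpec k L))

include hπ in
/-- **`pr₁^♯ c = c` on constants** (as elements of `L` via `k → L`): `pr₁ ≫ (A → Spec k) = pr₂ ≫ (Spec L → Spec k)`.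
[cite: GortzWedhorn2020, Section (4.7) and Prop. 4.16] -/
theorem functionFieldMap_baseChangeFst_algebraMap [IsDominant π] (c : k) :
    functionFieldMap π (algebraMap k A.X.left.functionField c) =
      algebraMap L (A.baseChange L).X.left.functionField (algebraMap k L c) := by
  rw [algebraMap_stalk_apply, algebraMap_stalk_apply]
  have hcond : π ≫ (A.X.left ↘ Spec (.of k)) = ((A.baseChange L).X.left ↘ Spec (.of L)) ≫ bcSpec k L := by
    rw [hπ]
    exact pullback.condition
  rw [functionFieldMap_algebraMap_top (A.X.left ↘ Spec (.of k)) π _ rfl c,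
    hcond, Scheme.Hom.comp_appTop, CommRingCat.comp_apply]
  congr 2
  have h := congrArg (fun φ => φ.hom c) (Scheme.ΓSpecIso_inv_naturality (CommRingCat.ofHom (algebraMap k L)))
  simp only [CommRingCat.hom_comp, RingHom.coe_comp, Function.comp_apply, CommRingCat.hom_ofHom] at h
  exact h.symm

include hπ in
/-- `pr₁ ≫ [n]_A = [n]_{A_L} ≫ pr₁`. [cite: GortzWedhorn2020, Section (4.7) and Prop. 4.16] -/
theorem baseChangeFst_comp_zsmul (n : ℤ) :
    π ≫ Hom.toSchemeHom (n • 𝟙 A) = Hom.toSchemeHom (n • 𝟙 (A.baseChange L)) ≫ π := by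
  rw [hπ, ← baseChange_zsmul_id]
  exact (toSchemeHom_baseChange_comp_fst L (n • 𝟙 A)).symm

include hπ in
/-- **`t_P ≫ pr₁ = pr₁ ≫ t_{P₀}`** for `P ∈ A_L(L)` lying over `P₀ ∈ A(k)` (`P ≫ pr₁ = (Spec L → Spec k) ≫ P₀`).
[cite: GortzWedhorn2023, Def. 27.1 (p. 799)] -/
theorem translation_left_comp_baseChangeFst (P : (A.baseChange L).Points L) (P₀ : A.Points k)
    (hP : P.left ≫ π = bcSpec k L ≫ P₀.left) :
    ((A.baseChange L).translation P).left ≫ π = π ≫ (A.translation P₀).left := by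
  subst hπ
  obtain ⟨s, rfl⟩ := (A.pointsMulEquiv L).surjective P
  have hs : s.left = bcSpec k L ≫ P₀.left := by
    rw [← A.pointsEquiv_apply_left_comp_fst L s]
    exact hP
  have h1 : ((A.baseChange L).translation (A.pointsMulEquiv L s)).left ≫ pullback.fst A.X.hom (bcSpec k L) =
      (A.constPt L s * A.fstPt L).left :=
    A.transl_fst L s
  have h2 : A.constPt L s = toSpecOver (A.bcOverK L) ≫ P₀ := by
    apply Over.OverMorphism.ext
    rw [constPt_left, hs, Over.comp_left, toSpecOver_left]
    exact (Category.assoc _ _ _).symm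
  have h3 : A.constPt L s * A.fstPt L = A.fstPt L ≫ A.translation P₀ := by
    rw [h2, translation, MonObj.comp_mul, Category.comp_id, ← Category.assoc, comp_toSpecOver_eq']
  rw [h1, h3, Over.comp_left, fstPt_left]
  rfl

include hπ in
/-- **The Weil pairing commutes with extension of scalars `L/k`**: for `P, Q ∈ A_L[N](L)` lying over
`P₀, Q₀ ∈ A[N](k)`, `ē_N^{pr₁^*Θ}(P, Q) = ē_N^Θ(P₀, Q₀)` (read in `L`). [cite: Lang1983AbelianVarieties, Ch. VII §2 Prop. 3]
[cite: Milne1986AbelianVarieties, §16 (p. 131, the pairings ē_m)] -/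
theorem weilPairingLevel_baseChange [IsDominant π] {N : ℕ} [IsDominant (Hom.toSchemeHom ((N : ℤ) • 𝟙 A))]
    [IsDominant (Hom.toSchemeHom ((N : ℤ) • 𝟙 (A.baseChange L)))]
    (Θ : CartierDivisor A.X.left) (P₀ Q₀ : A.torsionPoints k N) (P Q : (A.baseChange L).torsionPoints L N)
    (hP : (P : (A.baseChange L).Points L).left ≫ π = bcSpec k L ≫ (P₀ : A.Points k).left)
    (hQ : (Q : (A.baseChange L).Points L).left ≫ π = bcSpec k L ≫ (Q₀ : A.Points k).left) :
    (A.baseChange L).weilPairingLevel (Θ.pullback π) P Q = algebraMap k L (A.weilPairingLevel Θ P₀ Q₀) :=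
  weilPairingLevel_transport (algebraMap k L) π (A.functionFieldMap_baseChangeFst_algebraMap L π hπ)
    (A.baseChangeFst_comp_zsmul L π hπ N) Θ P₀ Q₀ P Q
    (A.translation_left_comp_baseChangeFst L π hπ P.1 P₀.1 hP)
    (A.translation_left_comp_baseChangeFst L π hπ Q.1 Q₀.1 hQ)

/-- The point `pointsMulEquiv P₀ ∈ A_L(L)` attached to `P₀ ∈ A(k) ⊆ A(L)`... stated for an `L`-point `s ∈ A(L)`
along `k → L`: it lies over `s` (`pointsEquiv_apply_left_comp_fst`), so the hypothesis of
`weilPairingLevel_baseChange` holds for `P := pointsMulEquiv s` whenever `s.left = (Spec L → Spec k) ≫ P₀.left`.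
[cite: GortzWedhorn2020, Section (4.7) (points of a base change)] -/
theorem pointsMulEquiv_left_comp_eq (s : A.Points L) (P₀ : A.Points k) (hs : s.left = bcSpec k L ≫ P₀.left) :
    (A.pointsMulEquiv L s).left ≫ pullback.fst A.X.hom (bcSpec k L) = bcSpec k L ≫ P₀.left := by
  rw [pointsMulEquiv_apply, pointsEquiv_apply_left_comp_fst, hs]

end BaseChange

end AbelianVariety

end Literature.AlgebraicGeometry.Motives

end
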